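import Mathlib
import Literature.Analysis.FluidPDE.ClassicalSolution
import Literature.Analysis.FluidPDE.RapidDecayLemmas
import Literature.Analysis.FluidPDE.ElgindiBlowup
import HarnessLib

/-!
# Flux duality assembly tools (line `Sketch`, crux `RecurrentLiouville` stmt-NavierStokesRegularity-1589)

Continuity and positivity of the adjoint masses `m(t) = ∫‖η(t)‖`, `b(t) = ∫Λ(t)‖η(t)‖` on a
compact window, for a uniformly rapidly decaying jointly smooth field `η` — the side conditions of
the Grönwall bookkeeping stub `stub_clockFluxDuality`.
-/

noncomputable section

set_option linter.dupNamespace false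

namespace Summit.NavierStokesRegularity.NavierStokesRegularity.Theorems

open MeasureTheory Set Function Filter Topology TopologicalSpace Metric
open Literature.Analysis Literature.Analysis.FluidPDE
open scoped NNReal ENNReal RealInnerProductSpace

/-- A jointly continuous integrand `F t x` on `S × ℝ³` dominated by `C(1 + ‖x‖)^{-4}` uniformly in
`t ∈ S` has a continuous integral `t ↦ ∫ F t x dx` on `S` (dominated convergence; `4 > 3`). -/
theorem clockFD_continuousOn_integral {S : Set ℝ}
    {F : ℝ → EuclideanSpace ℝ (Fin 3) → ℝ}
    (hc : ContinuousOn (uncurry F) (S ×ˢ univ)) {C : ℝ}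
    (hb : ∀ t ∈ S, ∀ x, ‖F t x‖ ≤ C * (1 + ‖x‖) ^ (-(4 : ℝ))) :
    ContinuousOn (fun t => ∫ x, F t x) S := by
  have hslice : ∀ t ∈ S, Continuous (F t) := fun t ht =>
    hc.comp_continuous (Continuous.prodMk_right t) fun x => mk_mem_prod ht (mem_univ x)
  have hr : (Module.finrank ℝ (EuclideanSpace ℝ (Fin 3)) : ℝ) < 4 := by
    rw [finrank_euclideanSpace_fin]; norm_num
  refine continuousOn_of_dominated (bound := fun x => C * (1 + ‖x‖) ^ (-(4 : ℝ)))
    (fun t ht => (hslice t ht).aestronglyMeasurable)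
    (fun t ht => Eventually.of_forall (hb t ht))
    ((integrable_one_add_norm hr).const_mul C) ?_
  refine Eventually.of_forall fun x => ?_
  exact hc.comp (continuousOn_id.prodMk continuousOn_const) fun t ht => mk_mem_prod ht (mem_univ x)

/-- **The adjoint mass is continuous on the window**: `t ↦ ∫‖η(t, x)‖dx` is continuous on `S` for
a jointly smooth, uniformly rapidly decaying `η`. -/
theorem clockFD_continuousOn_mass {S : Set ℝ}
    {η : ℝ → EuclideanSpace ℝ (Fin 3) → EuclideanSpace ℝ (Fin 3)}
    (hηs : IsSmoothSpaceTimeOn S η) (hηd : HasUniformRapidDecayOn S η) :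
    ContinuousOn (fun t => ∫ x, ‖η t x‖) S := by
  obtain ⟨C, -, hC⟩ := hηd.norm_le_rpow 4
  refine clockFD_continuousOn_integral (F := fun t x => ‖η t x‖) ?_ (C := C) ?_
  · exact (hηs.continuousOn).norm
  · intro t ht x
    rw [Real.norm_eq_abs, abs_norm]
    exact_mod_cast hC t ht x

/-- **The weighted adjoint mass is continuous on the window**: `t ↦ ∫ Λ(t,x)‖η(t, x)‖dx` is
continuous on `S` for `Λ` jointly continuous and bounded on `S × ℝ³`. -/
theorem clockFD_continuousOn_weighted {S : Set ℝ}
    {η : ℝ → EuclideanSpace ℝ (Fin 3) → EuclideanSpace ℝ (Fin 3)}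
    {Λ : ℝ → EuclideanSpace ℝ (Fin 3) → ℝ}
    (hηs : IsSmoothSpaceTimeOn S η) (hηd : HasUniformRapidDecayOn S η)
    (hΛc : ContinuousOn (uncurry Λ) (S ×ˢ univ))
    (hΛb : ∃ B : ℝ, ∀ t ∈ S, ∀ x : EuclideanSpace ℝ (Fin 3), 0 ≤ Λ t x ∧ Λ t x ≤ B) :
    ContinuousOn (fun t => ∫ x, Λ t x * ‖η t x‖) S := by
  obtain ⟨C, hC0, hC⟩ := hηd.norm_le_rpow 4
  obtain ⟨B, hB⟩ := hΛb
  refine clockFD_continuousOn_integral (F := fun t x => Λ t x * ‖η t x‖) ?_ (C := B * C) ?_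
  · exact hΛc.mul hηs.continuousOn.norm
  · intro t ht x
    have h1 := hC t ht x
    have h2 := hB t ht x
    rw [Real.norm_eq_abs, abs_mul, abs_norm, abs_of_nonneg h2.1, mul_assoc]
    have hB0 : 0 ≤ B := h2.1.trans h2.2
    calc Λ t x * ‖η t x‖ ≤ B * ‖η t x‖ := by gcongr; exact h2.2
      _ ≤ B * (C * (1 + ‖x‖) ^ (-(4 : ℝ))) := by gcongr; exact_mod_cast h1

/-- The adjoint mass slices are integrable. -/
theorem clockFD_integrable_norm {S : Set ℝ}
    {η : ℝ → EuclideanSpace ℝ (Fin 3) → EuclideanSpace ℝ (Fin 3)}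
    (hηs : IsSmoothSpaceTimeOn S η) (hηd : HasUniformRapidDecayOn S η) {t : ℝ} (ht : t ∈ S) :
    Integrable (fun x => ‖η t x‖) := by
  obtain ⟨C, -, hC⟩ := hηd.norm_le_rpow 4
  have hr : (Module.finrank ℝ (EuclideanSpace ℝ (Fin 3)) : ℝ) < 4 := by
    rw [finrank_euclideanSpace_fin]; norm_num
  refine integrable_of_norm_le_rpow_neg (hηs.continuous_slice ht).norm hr (C := C) fun x => ?_
  rw [norm_norm]
  exact_mod_cast hC t ht x

/-- **Pairing bound**: `|∫⟪ω, η(t)⟫| ≤ A ∫‖η(t)‖` whenever `‖ω‖ ≤ A` pointwise. -/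
theorem clockFD_abs_pairing_le {S : Set ℝ}
    {η : ℝ → EuclideanSpace ℝ (Fin 3) → EuclideanSpace ℝ (Fin 3)}
    (hηs : IsSmoothSpaceTimeOn S η) (hηd : HasUniformRapidDecayOn S η) {t : ℝ} (ht : t ∈ S)
    {ω : EuclideanSpace ℝ (Fin 3) → EuclideanSpace ℝ (Fin 3)} {A : ℝ} (hA : ∀ x, ‖ω x‖ ≤ A) :
    |∫ x, ⟪ω x, η t x⟫| ≤ A * ∫ x, ‖η t x‖ := by
  rw [← Real.norm_eq_abs, ← integral_const_mul]
  refine norm_integral_le_of_norm_le ((clockFD_integrable_norm hηs hηd ht).const_mul A)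
    (Eventually.of_forall fun x => ?_)
  calc ‖⟪ω x, η t x⟫‖ ≤ ‖ω x‖ * ‖η t x‖ := norm_inner_le_norm _ _
    _ ≤ A * ‖η t x‖ := by gcongr; exact hA x

/-- **Positivity of the adjoint mass from a non-degenerate pairing**: if `|P| ≤ A ∫‖η(t)‖` with
`P ≠ 0` then `∫‖η(t)‖ > 0`. -/
theorem clockFD_mass_pos {m P A : ℝ} (hle : |P| ≤ A * m) (hP : 0 < |P|) (hm : 0 ≤ m) : 0 < m := by
  rcases hm.lt_or_eq with h | h
  · exact h
  · rw [← h, mul_zero] at hle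
    exact absurd (hP.trans_le hle) (lt_irrefl _)

/-- **Registered tools stub `stub_clockMassContinuous`** (explicit-binder form of
`clockFD_continuousOn_mass`): the adjoint mass `t ↦ ‖η(t)‖₁` is continuous on the time set. -/
theorem stub_clockMassContinuous :
    ∀ (S : Set ℝ) (η : ℝ → EuclideanSpace ℝ (Fin 3) → EuclideanSpace ℝ (Fin 3)),
      IsSmoothSpaceTimeOn S η → HasUniformRapidDecayOn S η →
      ContinuousOn (fun t => ∫ x, ‖η t x‖) S :=
  fun _ _ hηs hηd => clockFD_continuousOn_mass hηs hηd

end Summit.NavierStokesRegularity.NavierStokesRegularity.Theorems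

end
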